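import Summits.QuantumFields.BalabanUV.Beta.FP.KernelPeriodisationFibTrace

/-!
# `BalabanUV.Beta.FP.KernelPeriodisationFibTraceRel` — road «FP» (binder row D1), RULING R-FP-51 row **(T-PER)**, PART 5 (owner's GO (P2), HOME/CLAIMS.log
# [D1P3-G16-GO-P1P2]): **THE PERIOD SUM IN THE RELATIVE INSERTION POINT** — for a bi-localised ℤ^{d+1} word `X` and a second, diagonally periodised localised
# insertion `dper M V`: `tr (X ∘ dper M V) = Σ'_j tr (X ∘ V(·+M∘j, ·+M∘j))` (§2); each translated-copy trace is exponentially small in the distances of the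
# localisation points (§1); the `j ≠ 0` copies add up to `O(e^{−(ε∕2)N})` for periods `M_i ≥ N` (§3)

Supplier: road-P3 lineage `b2b-balaban-gan24-p3` (gen 31).  NOT IN PRINT; OUR BOOKKEEPING ([folklore] Fubini on `lattice × sites` under the `BiLoc ∘ BiLoc` majorant of
`ExpKernelCalculus.biLoc_comp_biLoc`; imports PART 4 for `le_l1_Mmul`).  No `def`, no `Prop` minted, nothing cited.  With PART 4 (`trace_perF_dper`, `abs_trace_perF_dper_sub_tr_le`) this completes the
design sentence of [D1P3-G16-ROUTE-T]: «torus trace of a periodised localised word = the `Mℤ⁴`-periodisation of the ℤ⁴ word (in the relative insertion point) +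
wrap-around `O(e^{−cM})`».  CONTENT.  §1 `biLoc_shiftK` (a translated copy is bi-localised at the translated points), common-rate weakenings, **`abs_tr_comp_shiftK_le`**.
§2 the dominated family `(j, x) ↦ Σ_a (X ∘ V_j) x x a a` and **`tr_comp_dper : tr (X ∘ dper M V) = Σ'_j tr (X ∘ shiftK (M∘j) V)`**.  §3 **`abs_tr_comp_dper_sub_le`**:
`|tr (X ∘ dper M V) − tr (X ∘ V)| ≤ |F|²·C·C′·Zl(ε∕2)²·K_{d+1}(ε∕2)·e^{(ε∕2)|q−p′|₁}·e^{−(ε∕2)N}`, `ε = min δ δ′`, for `M_i ≥ N`.  Moves NO (CONV-C) clause and NO row-D1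
binder; NOT SDF, NOT D1, NOT BetaPertH, NOT continuum, NOT Clay.  HONEST DEPENDENCY: continuum YM on T⁴ ⇐ BetaPertH ∧ nine spine estimates (0/9 proved); BetaPertH ⇐ (D1) ∧
(D4) ∧ CAP+tail; G-an2-4 gates asym, D1 and NE2/3/4.
-/

noncomputable section

open scoped BigOperators
open Finset

namespace Summit.QuantumFields.BalabanUV.Beta.FP.KernelPeriodisationFibTraceRel

open Literature.MathematicalPhysics.QuantumFieldTheory.Balaban1983to89
open Literature.MathematicalPhysics.QuantumFieldTheory.Balaban1983to89.Beta
open B12Sec2to5 (l1 l1_nonneg)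
open B4TorusKernel.MultiPeriod (translate translate_apply)
open B4Sect5Proof (latticeConst latticeConst_nonneg)
open ExpKernelCalculus (MKer Decays BiLoc tr shiftK l1_sub_triangle l1_sub_symm summable_exp_shift' tsum_exp_shift' Zl Zl_nonneg biLoc_comp_biLoc
  abs_trTerm_le abs_tr_le)
open OneStepResolventKernel (biLoc_mono)
open Summit.QuantumFields.BalabanUV.Beta.FP.KernelPeriodisationFib (translate_eq_add)
open Summit.QuantumFields.BalabanUV.Beta.FP.KernelPeriodisationFibLoc (dper dper_apply summable_exp_l1_translate decays_of_biLoc comp_dper_apply_eq_tsum)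
open Summit.QuantumFields.BalabanUV.Beta.FP.KernelPeriodisationFibTrace (le_l1_Mmul)

variable {d : ℕ} {F : Type*} [Fintype F]

/-! ## §1 Translated copies are bi-localised at the translated points; the trace of `X ∘ V_v` -/

section Copies

variable {X V : MKer (d + 1) F} {C C' δ δ' : ℝ} {p q p' q' : Fin (d + 1) → ℤ}

omit [Fintype F] in
/-- **a translated copy `shiftK v V` of a kernel bi-localised at `(p′, q′)` is bi-localised at `(p′ − v, q′ − v)`, same constant and rate.** -/
theorem biLoc_shiftK (hV : BiLoc V p' q' C' δ') (v : Fin (d + 1) → ℤ) : BiLoc (shiftK v V) (p' - v) (q' - v) C' δ' := by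
  intro x y a b
  have h1 : x + v - p' = x - (p' - v) := by abel
  have h2 : y + v - q' = y - (q' - v) := by abel
  have := hV (x + v) (y + v) a b
  rwa [h1, h2] at this

omit [Fintype F] in
/-- weakening to the common rate `min δ δ′` (left factor). -/
theorem biLoc_min_left (hX : BiLoc X p q C δ) (hC : 0 ≤ C) (δ' : ℝ) : BiLoc X p q C (min δ δ') := biLoc_mono hX hC (min_le_left _ _)

omit [Fintype F] in
/-- weakening to the common rate `min δ δ′` (right factor). -/
theorem biLoc_min_right (hV : BiLoc V p' q' C' δ') (hC' : 0 ≤ C') (δ : ℝ) : BiLoc V p' q' C' (min δ δ') := biLoc_mono hV hC' (min_le_right _ _)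

/-- the word with one translated copy is bi-localised at `(p, q′ − v)` with a constant exponentially small in `|q − (p′ − v)|₁` (`biLoc_comp_biLoc`). -/
theorem biLoc_comp_shiftK (hX : BiLoc X p q C δ) (hV : BiLoc V p' q' C' δ') (hC : 0 ≤ C) (hC' : 0 ≤ C') (hδ : 0 < δ) (hδ' : 0 < δ')
    (v : Fin (d + 1) → ℤ) :
    BiLoc (ExpKernelCalculus.comp X (shiftK v V)) p (q' - v)
      ((Fintype.card F : ℝ) * (C * C') * Zl (d + 1) (min δ δ' / 2) * Real.exp (-(min δ δ' / 2) * l1 (q - (p' - v)))) (min δ δ') :=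
  biLoc_comp_biLoc (biLoc_min_left hX hC δ') (biLoc_shiftK (biLoc_min_right hV hC' δ) v) (lt_min hδ hδ')

/-- **the trace of the word with ONE translated copy is exponentially small in the distances of the localisation points**:
`|tr (X ∘ shiftK v V)| ≤ |F|·(|F|·C·C′·Zl(ε∕2)·e^{−(ε∕2)|q−(p′−v)|₁})·Zl(ε∕2)·e^{−(ε∕2)|p−(q′−v)|₁}`, `ε = min δ δ′`. [folklore] -/
theorem abs_tr_comp_shiftK_le (hX : BiLoc X p q C δ) (hV : BiLoc V p' q' C' δ') (hC : 0 ≤ C) (hC' : 0 ≤ C') (hδ : 0 < δ) (hδ' : 0 < δ')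
    (v : Fin (d + 1) → ℤ) :
    |tr (ExpKernelCalculus.comp X (shiftK v V))| ≤
      (Fintype.card F : ℝ) * ((Fintype.card F : ℝ) * (C * C') * Zl (d + 1) (min δ δ' / 2) * Real.exp (-(min δ δ' / 2) * l1 (q - (p' - v)))) *
        Zl (d + 1) (min δ δ' / 2) * Real.exp (-(min δ δ' / 2) * l1 (p - (q' - v))) :=
  abs_tr_le (biLoc_comp_shiftK hX hV hC hC' hδ hδ' v) (lt_min hδ hδ')

end Copies

/-! ## §2 `tr (X ∘ dper M V) = Σ'_j tr (X ∘ V_j)` -/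

section Sum

variable (M : Fin (d + 1) → ℕ) [∀ μ, NeZero (M μ)]
variable {X V : MKer (d + 1) F} {C C' δ δ' : ℝ} {p q p' q' : Fin (d + 1) → ℤ}

omit [∀ μ, NeZero (M μ)] in
/-- `q − (p′ − M∘j) = (q − p′) + M∘j` as a translate. -/
theorem sub_sub_Mmul (q p' j : Fin (d + 1) → ℤ) : q - (p' - fun i => (M i : ℤ) * j i) = translate M (q - p') j := by
  rw [translate_eq_add]; abel

omit [∀ μ, NeZero (M μ)] in
/-- the constant of the translated-copy word at `v = M∘j`, with the `j`-dependence displayed. -/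
theorem const_copy_eq (j : Fin (d + 1) → ℤ) :
    (Fintype.card F : ℝ) * (C * C') * Zl (d + 1) (min δ δ' / 2) * Real.exp (-(min δ δ' / 2) * l1 (q - (p' - fun i => (M i : ℤ) * j i))) =
      (Fintype.card F : ℝ) * (C * C') * Zl (d + 1) (min δ δ' / 2) * Real.exp (-(min δ δ' / 2) * l1 (translate M (q - p') j)) := by
  rw [sub_sub_Mmul]

omit [∀ μ, NeZero (M μ)] in
/-- a single diagonal entry of the translated-copy word is dominated uniformly in `x`: `|(X ∘ V_j) x x a b| ≤ K₀·e^{−(ε∕2)|(q−p′)+M∘j|₁}`. -/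
theorem abs_comp_copy_entry_le (hX : BiLoc X p q C δ) (hV : BiLoc V p' q' C' δ') (hC : 0 ≤ C) (hC' : 0 ≤ C') (hδ : 0 < δ) (hδ' : 0 < δ')
    (j x : Fin (d + 1) → ℤ) (a b : F) :
    |ExpKernelCalculus.comp X (shiftK (fun i => (M i : ℤ) * j i) V) x x a b| ≤
      (Fintype.card F : ℝ) * (C * C') * Zl (d + 1) (min δ δ' / 2) * Real.exp (-(min δ δ' / 2) * l1 (translate M (q - p') j)) := by
  have hε : 0 < min δ δ' := lt_min hδ hδ'
  have h := biLoc_comp_shiftK hX hV hC hC' hδ hδ' (fun i => (M i : ℤ) * j i) x x a b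
  rw [const_copy_eq M] at h
  refine h.trans ?_
  have hK : 0 ≤ (Fintype.card F : ℝ) * (C * C') * Zl (d + 1) (min δ δ' / 2) * Real.exp (-(min δ δ' / 2) * l1 (translate M (q - p') j)) := by
    have := Zl_nonneg (D := d + 1) (half_pos hε); positivity
  have h1 : Real.exp (-(min δ δ') * (l1 (x - p) + l1 (x - (q' - fun i => (M i : ℤ) * j i)))) ≤ 1 :=
    Real.exp_le_one_iff.2 (by nlinarith [l1_nonneg (x - p), l1_nonneg (x - (q' - fun i => (M i : ℤ) * j i)), hε.le])
  calc _ ≤ (Fintype.card F : ℝ) * (C * C') * Zl (d + 1) (min δ δ' / 2) * Real.exp (-(min δ δ' / 2) * l1 (translate M (q - p') j)) * 1 :=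
        mul_le_mul_of_nonneg_left h1 hK
    _ = _ := mul_one _

omit [∀ μ, NeZero (M μ)] in
/-- the diagonal fibre sums of the translated-copy words are dominated: `|Σ_a (X ∘ V_j) x x a a| ≤ |F|·K₀·e^{−(ε∕2)|(q−p′)+M∘j|₁}·e^{−(ε∕2)|x−p|₁}`. -/
theorem abs_trTerm_copy_le (hX : BiLoc X p q C δ) (hV : BiLoc V p' q' C' δ') (hC : 0 ≤ C) (hC' : 0 ≤ C') (hδ : 0 < δ) (hδ' : 0 < δ')
    (j x : Fin (d + 1) → ℤ) :
    |∑ a, ExpKernelCalculus.comp X (shiftK (fun i => (M i : ℤ) * j i) V) x x a a| ≤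
      (Fintype.card F : ℝ) * ((Fintype.card F : ℝ) * (C * C') * Zl (d + 1) (min δ δ' / 2)) *
        (Real.exp (-(min δ δ' / 2) * l1 (translate M (q - p') j)) * Real.exp (-(min δ δ' / 2) * l1 (x - p))) := by
  have hε : 0 < min δ δ' := lt_min hδ hδ'
  have h := abs_trTerm_le (biLoc_comp_shiftK hX hV hC hC' hδ hδ' (fun i => (M i : ℤ) * j i)) hε.le x
  rw [const_copy_eq M] at h
  refine h.trans ?_
  have hA : 0 ≤ (Fintype.card F : ℝ) * ((Fintype.card F : ℝ) * (C * C') * Zl (d + 1) (min δ δ' / 2) *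
      Real.exp (-(min δ δ' / 2) * l1 (translate M (q - p') j))) := by
    have := Zl_nonneg (D := d + 1) (half_pos hε); positivity
  have h1 : Real.exp (-(min δ δ' / 2) * l1 (p - (q' - fun i => (M i : ℤ) * j i))) ≤ 1 :=
    Real.exp_le_one_iff.2 (by nlinarith [l1_nonneg (p - (q' - fun i => (M i : ℤ) * j i)), hε.le])
  calc (Fintype.card F : ℝ) * ((Fintype.card F : ℝ) * (C * C') * Zl (d + 1) (min δ δ' / 2) *
          Real.exp (-(min δ δ' / 2) * l1 (translate M (q - p') j))) *
          Real.exp (-(min δ δ' / 2) * l1 (p - (q' - fun i => (M i : ℤ) * j i))) * Real.exp (-(min δ δ' / 2) * l1 (x - p))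
      ≤ (Fintype.card F : ℝ) * ((Fintype.card F : ℝ) * (C * C') * Zl (d + 1) (min δ δ' / 2) *
          Real.exp (-(min δ δ' / 2) * l1 (translate M (q - p') j))) * 1 * Real.exp (-(min δ δ' / 2) * l1 (x - p)) := by
        gcongr
    _ = _ := by ring

/-- the lattice family `j ↦ (X ∘ V_j) x x a b` is summable (one entry). -/
theorem summable_comp_copy_entry (hX : BiLoc X p q C δ) (hV : BiLoc V p' q' C' δ') (hC : 0 ≤ C) (hC' : 0 ≤ C') (hδ : 0 < δ) (hδ' : 0 < δ')
    (x : Fin (d + 1) → ℤ) (a b : F) :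
    Summable fun j : Fin (d + 1) → ℤ => ExpKernelCalculus.comp X (shiftK (fun i => (M i : ℤ) * j i) V) x x a b := by
  have hε2 : 0 < min δ δ' / 2 := half_pos (lt_min hδ hδ')
  obtain ⟨hs, -⟩ := summable_exp_l1_translate M hε2 0 (q - p')
  simp only [sub_zero] at hs
  refine (hs.mul_left ((Fintype.card F : ℝ) * (C * C') * Zl (d + 1) (min δ δ' / 2))).of_norm_bounded fun j => ?_
  rw [Real.norm_eq_abs]
  exact abs_comp_copy_entry_le M hX hV hC hC' hδ hδ' j x a b

/-- the family `(j, x) ↦ Σ_a (X ∘ V_j) x x a a` is summable on `lattice × sites`. -/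
theorem summable_trTerm_copies (hX : BiLoc X p q C δ) (hV : BiLoc V p' q' C' δ') (hC : 0 ≤ C) (hC' : 0 ≤ C') (hδ : 0 < δ) (hδ' : 0 < δ') :
    Summable (Function.uncurry fun (j x : Fin (d + 1) → ℤ) => ∑ a, ExpKernelCalculus.comp X (shiftK (fun i => (M i : ℤ) * j i) V) x x a a) := by
  have hε2 : 0 < min δ δ' / 2 := half_pos (lt_min hδ hδ')
  obtain ⟨hs, -⟩ := summable_exp_l1_translate M hε2 0 (q - p')
  simp only [sub_zero] at hs
  have hmaj := ((hs.mul_of_nonneg (summable_exp_shift' hε2 p) (fun _ => (Real.exp_pos _).le) fun _ => (Real.exp_pos _).le).mul_left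
    ((Fintype.card F : ℝ) * ((Fintype.card F : ℝ) * (C * C') * Zl (d + 1) (min δ δ' / 2))))
  refine hmaj.of_norm_bounded fun jx => ?_
  obtain ⟨j, x⟩ := jx
  rw [Function.uncurry_apply_pair, Real.norm_eq_abs]
  exact abs_trTerm_copy_le M hX hV hC hC' hδ hδ' j x

/-- **`tr_comp_dper` — THE PERIOD SUM IN THE RELATIVE INSERTION POINT**: `tr (X ∘ dper M V) = Σ'_j tr (X ∘ shiftK (M∘j) V)` for bi-localised `X`, `V`. [folklore] -/
theorem tr_comp_dper (hX : BiLoc X p q C δ) (hV : BiLoc V p' q' C' δ') (hδ : 0 < δ) (hδ' : 0 < δ') :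
    tr (ExpKernelCalculus.comp X (dper M V)) =
      ∑' j : Fin (d + 1) → ℤ, tr (ExpKernelCalculus.comp X (shiftK (fun i => (M i : ℤ) * j i) V)) := by
  rcases isEmpty_or_nonempty F with hF | ⟨⟨a₀⟩⟩
  · simp only [ExpKernelCalculus.tr, Finset.univ_eq_empty, Finset.sum_empty, tsum_zero]
  have hC : 0 ≤ C := hX.nonneg a₀
  have hC' : 0 ≤ C' := hV.nonneg a₀
  simp only [ExpKernelCalculus.tr]
  calc ∑' x, ∑ a, ExpKernelCalculus.comp X (dper M V) x x a a
      = ∑' x, ∑ a, ∑' j : Fin (d + 1) → ℤ, ExpKernelCalculus.comp X (shiftK (fun i => (M i : ℤ) * j i) V) x x a a := by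
        refine tsum_congr fun x => Finset.sum_congr rfl fun a _ => ?_
        exact comp_dper_apply_eq_tsum M (decays_of_biLoc hX hC hδ.le) hδ hV hδ' x x a a
    _ = ∑' x, ∑' j : Fin (d + 1) → ℤ, ∑ a, ExpKernelCalculus.comp X (shiftK (fun i => (M i : ℤ) * j i) V) x x a a := by
        refine tsum_congr fun x => ?_
        exact (Summable.tsum_finsetSum fun a _ => summable_comp_copy_entry M hX hV hC hC' hδ hδ' x a a).symm
    _ = ∑' j : Fin (d + 1) → ℤ, ∑' x, ∑ a, ExpKernelCalculus.comp X (shiftK (fun i => (M i : ℤ) * j i) V) x x a a :=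
        (summable_trTerm_copies M hX hV hC hC' hδ hδ').tsum_comm

end Sum

/-! ## §3 The `j ≠ 0` copies are the wrap-around: `O(e^{−(ε∕2)N})` -/

section Tail

variable (M : Fin (d + 1) → ℕ) [∀ μ, NeZero (M μ)]
variable {X V : MKer (d + 1) F} {C C' δ δ' : ℝ} {p q p' q' : Fin (d + 1) → ℤ}

omit [Fintype F] [∀ μ, NeZero (M μ)] in
/-- `shiftK 0` (the `j = 0` copy) is the identity. -/
theorem shiftK_Mmul_zero (V : MKer (d + 1) F) : shiftK (fun i => (M i : ℤ) * (0 : Fin (d + 1) → ℤ) i) V = V := by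
  funext x y a b
  simp only [shiftK, Pi.zero_apply, mul_zero]
  congr 1 <;> funext i <;> simp

omit [∀ μ, NeZero (M μ)] in
/-- for `j ≠ 0` and `M_i ≥ N`: `|(q−p′) + M∘j|₁ ≥ N − |q−p′|₁`. -/
theorem le_l1_translate_of_ne_zero {N : ℕ} (hMN : ∀ i, N ≤ M i) (w : Fin (d + 1) → ℤ) {j : Fin (d + 1) → ℤ} (hj : j ≠ 0) :
    (N : ℝ) - l1 w ≤ l1 (translate M w j) := by
  have h0 := le_l1_Mmul M hMN hj
  have h1 : l1 (translate M w j - w) ≤ l1 (translate M w j - 0) + l1 (0 - w) := l1_sub_triangle _ _ _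
  have h2 : translate M w j - w = fun i => (M i : ℤ) * j i := by rw [translate_eq_add]; abel
  rw [h2, sub_zero, l1_sub_symm 0 w, sub_zero] at h1
  linarith

/-- the lattice family `j ↦ tr (X ∘ V_j)` is summable. -/
theorem summable_tr_copies (hX : BiLoc X p q C δ) (hV : BiLoc V p' q' C' δ') (hC : 0 ≤ C) (hC' : 0 ≤ C') (hδ : 0 < δ) (hδ' : 0 < δ') :
    Summable fun j : Fin (d + 1) → ℤ => tr (ExpKernelCalculus.comp X (shiftK (fun i => (M i : ℤ) * j i) V)) := by
  have h := (summable_trTerm_copies M hX hV hC hC' hδ hδ').prod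
  simpa only [ExpKernelCalculus.tr, Function.uncurry_apply_pair] using h

omit [∀ μ, NeZero (M μ)] in
/-- termwise tail bound: for every `j`, `|ite (j = 0) 0 (tr (X ∘ V_j))| ≤ B·e^{−(ε∕2)N}·e^{−(ε∕2)|(p−q′)+M∘j|₁}`,
`B = |F|²·C·C′·Zl(ε∕2)²·e^{(ε∕2)|q−p′|₁}`. -/
theorem abs_ite_tr_copy_le (hX : BiLoc X p q C δ) (hV : BiLoc V p' q' C' δ') (hC : 0 ≤ C) (hC' : 0 ≤ C') (hδ : 0 < δ) (hδ' : 0 < δ') {N : ℕ}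
    (hMN : ∀ i, N ≤ M i) (j : Fin (d + 1) → ℤ) :
    |(if j = 0 then (0 : ℝ) else tr (ExpKernelCalculus.comp X (shiftK (fun i => (M i : ℤ) * j i) V)))| ≤
      (Fintype.card F : ℝ) * ((Fintype.card F : ℝ) * (C * C') * Zl (d + 1) (min δ δ' / 2)) * Zl (d + 1) (min δ δ' / 2) *
        Real.exp (min δ δ' / 2 * l1 (q - p')) * Real.exp (-(min δ δ' / 2 * N)) * Real.exp (-(min δ δ' / 2) * l1 (translate M (p - q') j)) := by
  have hε : 0 < min δ δ' := lt_min hδ hδ'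
  have hZ : 0 ≤ Zl (d + 1) (min δ δ' / 2) := Zl_nonneg (half_pos hε)
  split_ifs with hj
  · rw [abs_zero]; positivity
  · refine (abs_tr_comp_shiftK_le hX hV hC hC' hδ hδ' _).trans ?_
    rw [sub_sub_Mmul M q p' j, sub_sub_Mmul M p q' j]
    have hgeo := le_l1_translate_of_ne_zero M hMN (q - p') hj
    have hkey : Real.exp (-(min δ δ' / 2) * l1 (translate M (q - p') j)) ≤
        Real.exp (min δ δ' / 2 * l1 (q - p')) * Real.exp (-(min δ δ' / 2 * N)) := by
      rw [← Real.exp_add, Real.exp_le_exp]; nlinarith [hε.le]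
    calc (Fintype.card F : ℝ) * ((Fintype.card F : ℝ) * (C * C') * Zl (d + 1) (min δ δ' / 2) *
            Real.exp (-(min δ δ' / 2) * l1 (translate M (q - p') j))) * Zl (d + 1) (min δ δ' / 2) *
            Real.exp (-(min δ δ' / 2) * l1 (translate M (p - q') j))
        ≤ (Fintype.card F : ℝ) * ((Fintype.card F : ℝ) * (C * C') * Zl (d + 1) (min δ δ' / 2) *
            (Real.exp (min δ δ' / 2 * l1 (q - p')) * Real.exp (-(min δ δ' / 2 * N)))) * Zl (d + 1) (min δ δ' / 2) *
            Real.exp (-(min δ δ' / 2) * l1 (translate M (p - q') j)) := by gcongr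
      _ = _ := by ring

/-- **`abs_tr_comp_dper_sub_le` — THE `j ≠ 0` COPIES ARE THE WRAP-AROUND**: for periods `M_i ≥ N`,
`|tr (X ∘ dper M V) − tr (X ∘ V)| ≤ |F|²·C·C′·Zl(ε∕2)²·K_{d+1}(ε∕2)·e^{(ε∕2)|q−p′|₁}·e^{−(ε∕2)N}` (`ε = min δ δ′`). [folklore] -/
theorem abs_tr_comp_dper_sub_le (hX : BiLoc X p q C δ) (hV : BiLoc V p' q' C' δ') (hδ : 0 < δ) (hδ' : 0 < δ') {N : ℕ} (hMN : ∀ i, N ≤ M i) :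
    |tr (ExpKernelCalculus.comp X (dper M V)) - tr (ExpKernelCalculus.comp X V)| ≤
      (Fintype.card F : ℝ) * ((Fintype.card F : ℝ) * (C * C') * Zl (d + 1) (min δ δ' / 2)) * Zl (d + 1) (min δ δ' / 2) *
        latticeConst (d + 1) (min δ δ' / 2) * Real.exp (min δ δ' / 2 * l1 (q - p')) * Real.exp (-(min δ δ' / 2 * N)) := by
  classical
  rcases isEmpty_or_nonempty F with hF | ⟨⟨a₀⟩⟩
  · have h0 : ∀ K : MKer (d + 1) F, tr K = 0 := fun K => by
      simp only [ExpKernelCalculus.tr, Finset.univ_eq_empty, Finset.sum_empty, tsum_zero]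
    rw [h0, h0, sub_zero, abs_zero, Fintype.card_eq_zero, Nat.cast_zero]
    simp
  have hC : 0 ≤ C := hX.nonneg a₀
  have hC' : 0 ≤ C' := hV.nonneg a₀
  have hε2 : 0 < min δ δ' / 2 := half_pos (lt_min hδ hδ')
  obtain ⟨hs, hle⟩ := summable_exp_l1_translate M hε2 0 (p - q')
  simp only [sub_zero] at hs hle
  rw [tr_comp_dper M hX hV hδ hδ', (summable_tr_copies M hX hV hC hC' hδ hδ').tsum_eq_add_tsum_ite 0, shiftK_Mmul_zero,
    add_sub_cancel_left]
  set B := (Fintype.card F : ℝ) * ((Fintype.card F : ℝ) * (C * C') * Zl (d + 1) (min δ δ' / 2)) * Zl (d + 1) (min δ δ' / 2) *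
    Real.exp (min δ δ' / 2 * l1 (q - p')) * Real.exp (-(min δ δ' / 2 * N)) with hB
  have hB0 : 0 ≤ B := by
    have := Zl_nonneg (D := d + 1) hε2; rw [hB]; positivity
  have hg := hs.mul_left B
  have hb := tsum_of_norm_bounded hg.hasSum fun j => by
    rw [Real.norm_eq_abs]
    have := abs_ite_tr_copy_le M hX hV hC hC' hδ hδ' hMN j
    rw [hB]; exact this
  rw [Real.norm_eq_abs] at hb
  refine hb.trans ?_
  rw [tsum_mul_left]
  calc B * ∑' j : Fin (d + 1) → ℤ, Real.exp (-(min δ δ' / 2) * l1 (translate M (p - q') j))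
      ≤ B * latticeConst (d + 1) (min δ δ' / 2) := mul_le_mul_of_nonneg_left hle hB0
    _ = _ := by rw [hB]; ring

end Tail

end Summit.QuantumFields.BalabanUV.Beta.FP.KernelPeriodisationFibTraceRel

end
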